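import Literature.Probability.Percolation.ArmSeparationIntFrame
import HarnessLib

/-!
# The fence of a lowest crossing at an internal extremity, stopped at a set (twin of `TrapFenceGen.lean`)

Topic `Literature/Probability/Percolation`; family `crit-perc` / near-critical percolation on `𝕋`.
A brick of the INNER half of the near-critical arm-separation theorem for four arms in the ADJACENT
colour arrangement (P. Nolin, EJP 13 (2008), Thm. 11, `j = 4`, `σ = BBWW` [arXiv 0711.4948:
Thm. 10], §4.4 Lemma 15 [arXiv Lemma 14], internal extremities; Kesten 1987, Lemma 2, fences):
`int_exists_fence` (`ArmSeparationIntFrame.lean`) with a STOPPING SET `S ⊇ c` of sites of norm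
`≥ m` — the fence inside `Λ_m` is followed from the corner box until the first site adjacent to `S`
(with `S = c ∪ (arms)` this attaches the fence to the first of the two met along the frame, as the
pair surgery needs). The proof is that of `int_exists_fence` with the exit taken at `S` instead of
`c` (`int_exists_fence_gen`).

Everything here is proved; no named facts are introduced.

## References

* P. Nolin, Near-critical percolation in two dimensions, *Electron. J. Probab.* 13 (2008), §4.4
  Lemma 15, internal extremities (arXiv 0711.4948: Lemma 14; proof of Thm. 10, p. 13) [Nolin2008].
* H. Kesten, Scaling relations for 2D-percolation, *Comm. Math. Phys.* 109 (1987), Lemma 2 [Kesten1987].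
-/

noncomputable section

open Set

namespace Literature.Probability.Percolation

open LatticeModels HalfAnnulus

/-- **The fence of an open crossing of the inner half-annulus, stopped at a set `S ⊇ c`** of sites
of norm `≥ m` (`m ≥ 5`, `1 ≤ k`, tip at distance `> 2k` from both ends of the side): an open
vertical crossing of the corner box `[m-2k, m-k] × [z₁+k, z₁+2k]` inside `Λ_m` through a site `mm`,
a site `q ∈ S`, a neighbour `p` of `q`, and an open `S`-avoiding path from `p` to `mm` in the inner
zone whose half-annulus sites are above `c` and whose inner sites are strictly above the row of `z`. [cite: Nolin2008, §4.4 Lemma 15 (proof), internal extremities (arXiv 0711.4948: Lemma 14)] [cite: Kesten1987, Lemma 2] -/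
theorem int_exists_fence_gen {m k : ℕ} {c : Finset (Site 2)} {z : Site 2} (hm : 5 ≤ m) (hk : 1 ≤ k)
    (hc : (intDom m).IsCrossing c z) (htk : -(m : ℤ) + 2 * k + 1 ≤ z 1 ∧ z 1 ≤ -(2 * (k : ℤ) + 1))
    {ω ω' : SiteConfig (Site 2)} (hagree : ∀ v, v ∉ (intDom m).lower c z → (v ∈ ω' ↔ v ∈ ω))
    (hframe : ω' ∈ triFrameAt z k) {S : Set (Site 2)} (hcS : (↑c : Set (Site 2)) ⊆ S) (hSn : ∀ v ∈ S, (m : ℤ) ≤ triNorm v) :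
    ∃ mm : Site 2, OpenVCrossThrough (triStrip (z 0 - 2 * k) (z 1 + k) k k) (z 1 + k) (z 1 + 2 * k) ω mm ∧
      ∃ q ∈ S, ∃ p : Site 2, triGraph.Adj q p ∧
        PathIn triGraph ((intFrameZone m z k ∩
          {v | ((m : ℤ) ≤ triNorm v → v ∈ (intDom m).above c z) ∧ (triNorm v < m → z 1 < v 1)}) ∩ ω ∩ Sᶜ) p mm := by
  have hk' : (1 : ℤ) ≤ k := by exact_mod_cast hk
  have hzJ := tip_isIntJ hc
  unfold IsIntJ at hzJ
  obtain ⟨hz0, hz1, hz2⟩ := hzJ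
  obtain ⟨F⟩ := nonempty_frameData hframe
  -- sites off the half-annulus are off `lower c z`, hence carry the same colour in `ω`, `ω'`
  have hlowD : ∀ v ∈ (intDom m).lower c z, v ∈ haFin m := fun v hv => JDomain.lower_subset_D hc.subset hv
  have hinn : ∀ v : Site 2, triNorm v < m → (v ∈ ω' ↔ v ∈ ω) := by
    intro v hv
    refine hagree v fun h => ?_
    have := (mem_haFin.1 (hlowD v h)).2.1
    omega
  -- the left strip is inside the inner half-hexagon
  have hWinn : ∀ v : Site 2, z 0 - 2 * k ≤ v 0 → v 0 ≤ z 0 - k → z 1 - 2 * k ≤ v 1 → v 1 ≤ z 1 + 2 * k →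
      triNorm v < m := by
    intro v h1 h2 h3 h4
    rw [triNorm_eq_max]; omega
  -- the upper part of the left crossing: a vertical crossing `V'` of the fence box
  obtain ⟨e₁, e₂, he₁, he₂, hV⟩ := F.pathW.exists_slab_crossing 1 (L := z 1 + k) (R := z 1 + 2 * k)
    (by omega) (by rw [F.xW1]; omega) (by rw [F.yW1])
  obtain ⟨SV, hSV, pV, tV⟩ := hV.exists_support
  have hSVb : ∀ v ∈ SV, z 0 - 2 * k ≤ v 0 ∧ v 0 ≤ z 0 - k ∧ z 1 + k ≤ v 1 ∧ v 1 ≤ z 1 + 2 * k := by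
    intro v hv
    have h1 := F.boundsW (hSV hv).1
    have h2 := (hSV hv).2
    simp only [Set.mem_setOf_eq] at h2
    omega
  have hSVω : SV ⊆ triStrip (z 0 - 2 * k) (z 1 + k) k k ∩ ω := by
    intro v hv
    have hb := hSVb v hv
    refine ⟨?_, (hinn v (hWinn v hb.1 hb.2.1 (by omega) hb.2.2.2)).1 ((F.SW_sub (hSV hv).1).2)⟩
    rw [mem_triStrip]; omega
  -- the top crossing meets `V'` at `mm`
  obtain ⟨mm, hmN, hmV⟩ := PathIn.tri_crossings_meet (L := z 0 - 2 * k) (R := z 0 + 2 * k)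
    (B := z 1 + k) (T := z 1 + 2 * k) (fun v hv => by have := F.boundsN hv; omega)
    (fun v hv => by have := hSVb v hv; omega) F.pathN F.xN0 F.yN0 pV he₁ he₂
  refine ⟨mm, ⟨e₁, e₂, he₁, he₂, (tV mm hmV).mono hSVω, ((tV mm hmV).symm.trans pV).mono hSVω⟩, ?_⟩
  -- `c` (hence `S`) meets `Yr`
  have hmY : mm ∈ F.Yr := Or.inl (Or.inl hmN)
  obtain ⟨f, hfc, hfF⟩ := hc.exists_start
  have hfout : f 0 ≤ z 0 - 2 * k ∨ z 0 + 2 * k ≤ f 0 ∨ f 1 ≤ z 1 - 2 * k ∨ z 1 + 2 * k ≤ f 1 := by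
    obtain ⟨hf, hfF'⟩ := mem_intDom_F.1 hfF
    obtain ⟨hf0, -, hfN⟩ := mem_haFin.1 hf
    rcases hfF' with h | h
    · left; omega
    · rw [triNorm_eq_max] at h; omega
  obtain ⟨y, hyc, hyK⟩ := F.exists_mem_K hk (s := z) (t := f) (by omega) hfout (hc.conn z hc.tip_mem f hfc)
  have hyc' : y ∈ c := Finset.mem_coe.1 hyc
  have hyY : y ∈ F.Yr := by
    rcases hyK with ((hy | hy) | hy) | hy
    · exact Or.inl (Or.inl hy)
    · exact Or.inl (Or.inr hy)
    · exfalso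
      have hb := F.boundsW hy
      have h1 := (mem_haFin.1 (hc.subset hyc')).2.1
      have h2 := hWinn y hb.1 hb.2.1 hb.2.2.1 hb.2.2.2
      omega
    · exact Or.inr hy
  -- follow `Yr` from `mm` to the first site adjacent to `S`
  have hminn : triNorm mm < m := hWinn mm (hSVb mm hmV).1 (hSVb mm hmV).2.1 (by have := hSVb mm hmV; omega)
    (hSVb mm hmV).2.2.2
  have hmS : mm ∈ Sᶜ := fun h => by have := hSn mm h; omega
  obtain ⟨p, q, hpS, hqS, hqY, hpq, hmp⟩ := (F.pathIn_Yr hk hmY hyY).exit (R := Sᶜ) hmS (fun h => h (hcS hyc))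
  have hqS' : q ∈ S := not_not.1 hqS
  have hmp' : PathIn triGraph ((F.Yr \ ↑c) ∩ Sᶜ) mm p :=
    hmp.mono fun v hv => ⟨⟨hv.2, fun hvc => hv.1 (hcS hvc)⟩, hv.1⟩
  -- the invariant along this path
  set G : Set (Site 2) := {v | ((m : ℤ) ≤ triNorm v → v ∈ (intDom m).above c z) ∧ (triNorm v < m → z 1 < v 1)} with hG
  have hmG : mm ∈ G := ⟨fun h => absurd hminn (not_lt.2 h), fun _ => by have := (hSVb mm hmV).2.2.1; omega⟩
  have hpath : PathIn triGraph (((F.Yr \ ↑c) ∩ Sᶜ) ∩ G) mm p :=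
    hmp'.inter_of_invariant hmG fun x w hx hxG hw hxw => int_invariant_step hm hk hc htk F hx.1 hw.1 hxw hxG.1 hxG.2
  -- sites satisfying the invariant are open sites of the zone
  have hsub : ((F.Yr \ ↑c) ∩ Sᶜ) ∩ G ⊆ (intFrameZone m z k ∩ G) ∩ ω ∩ Sᶜ := by
    rintro v ⟨⟨⟨hvY, -⟩, hvS⟩, hvin, hvout⟩
    have hb := F.boundsK (F.Yr_subset_K hvY)
    have hvω' : v ∈ ω' := F.K_subset (F.Yr_subset_K hvY)
    by_cases hvn : (m : ℤ) ≤ triNorm v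
    · have hvD : v ∈ haFin m := by
        refine mem_haFin.2 ⟨by omega, hvn, ?_⟩
        rw [triNorm_eq_max]; omega
      refine ⟨⟨⟨⟨Or.inl (by rw [← coe_haFin]; exact Finset.mem_coe.2 hvD), by omega, by omega, by omega, by omega⟩, hvin, hvout⟩, ?_⟩, hvS⟩
      have hva := hvin hvn
      have hvl : v ∉ (intDom m).lower c z := fun h =>
        ((JDomain.mem_lower_iff_not_mem_above (show v ∈ (intDom m).D from hvD)).1 h) hva
      exact (hagree v hvl).1 hvω'
    · rw [not_le] at hvn
      exact ⟨⟨⟨⟨Or.inr ⟨⟨by omega, hvn⟩, hvout hvn⟩, by omega, by omega, by omega, by omega⟩, hvin, hvout⟩, (hinn v hvn).1 hvω'⟩, hvS⟩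
  exact ⟨q, hqS', p, hpq.symm, (hpath.mono hsub).symm⟩

end Literature.Probability.Percolation
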